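import Mathlib.MeasureTheory.Measure.Haar.Quotient

/-!
# T5QuotientMeasureInvariance — the quotient measure `μ_𝓕` on `G ⧸ Γ` is `G`-invariant

Cell pub-hodge-repro2, seat p5, Tier 5 (route/T5-N4-p5.md, N4.3 v13 (B2): «the right coset space
and its INVARIANT Radon measure of [DE] p0234 l. 15»).  Rows 59 / 61 (`T5KernelIdentity`,
`T5RightCosetDecomposition`) take the `G`-invariance of `μ_𝓕 = map mk (μ.restrict 𝓕)` as the
instance hypothesis `[SMulInvariantMeasure G (G ⧸ Γ) μ_𝓕]`; Mathlib proves it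
(`QuotientMeasureEqMeasurePreimage.smulInvariantMeasure_quotient`) only under a `PolishSpace`
hypothesis on `G`.  This file proves it directly, for every topological group `G` with its Borel
σ-algebra, from a left- and right-invariant `μ` (a unimodular Haar measure) and a countable `Γ`:

* `quotientMeasure_apply`: `μ_𝓕 U = μ (mk ⁻¹' U ∩ 𝓕)`;
* `preimage_mk_preimage_smul`: `mk ⁻¹' ((g • ·) ⁻¹' A) = (g * ·) ⁻¹' (mk ⁻¹' A)`;
* `preimage_smul_preimage_mk`: `mk ⁻¹' A` is invariant under the right action of `Γ.op`;
* `smulInvariantMeasure_quotientMeasure`: **`μ_𝓕` is `G`-invariant** — by left invariance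
  `μ ((g * ·) ⁻¹' (mk ⁻¹' A) ∩ 𝓕) = μ (mk ⁻¹' A ∩ g • 𝓕)`, and `g • 𝓕` is again a fundamental
  domain of `Γ.op` (`IsFundamentalDomain.smul_of_comm`), so the two measures of the
  `Γ.op`-invariant set `mk ⁻¹' A` against the two fundamental domains agree
  (`IsFundamentalDomain.measure_set_eq`).

Mathlib only.  Axioms: propext, Classical.choice, Quot.sound.
README §8(d): uses an L-value-free non-vanishing device: NO.
-/

namespace Summit.Ventures.HodgeRepro2.T5QuotientMeasureInvariance

open MeasureTheory Set
open scoped ENNReal Pointwise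

variable {G : Type*} [Group G] [TopologicalSpace G] [IsTopologicalGroup G] [MeasurableSpace G]
  [BorelSpace G] {Γ : Subgroup G}

attribute [-instance] Quotient.instMeasurableSpace

variable [MeasurableSpace (G ⧸ Γ)] [BorelSpace (G ⧸ Γ)]

omit [IsTopologicalGroup G] in
/-- The quotient map `G → G ⧸ Γ` is measurable (it is continuous). -/
theorem measurable_mk : Measurable (QuotientGroup.mk : G → G ⧸ Γ) :=
  continuous_quotient_mk'.measurable

omit [IsTopologicalGroup G] in
/-- `μ_𝓕 U = μ (mk ⁻¹' U ∩ 𝓕)` for measurable `U`. -/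
theorem quotientMeasure_apply (μ : Measure G) (𝓕 : Set G) {U : Set (G ⧸ Γ)}
    (hU : MeasurableSet U) :
    Measure.map (QuotientGroup.mk : G → G ⧸ Γ) (μ.restrict 𝓕) U =
      μ ((QuotientGroup.mk : G → G ⧸ Γ) ⁻¹' U ∩ 𝓕) := by
  rw [Measure.map_apply measurable_mk hU, Measure.restrict_apply (measurable_mk hU)]

omit [TopologicalSpace G] [IsTopologicalGroup G] [MeasurableSpace G] [BorelSpace G]
  [MeasurableSpace (G ⧸ Γ)] [BorelSpace (G ⧸ Γ)] in
/-- The preimage under `mk` of the `g`-translate of `A` is the left `g`-translate of the preimage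
of `A`. -/
theorem preimage_mk_preimage_smul (g : G) (A : Set (G ⧸ Γ)) :
    (QuotientGroup.mk : G → G ⧸ Γ) ⁻¹' ((g • ·) ⁻¹' A) =
      (g * ·) ⁻¹' ((QuotientGroup.mk : G → G ⧸ Γ) ⁻¹' A) := by
  ext x
  simp

omit [TopologicalSpace G] [IsTopologicalGroup G] [MeasurableSpace G] [BorelSpace G]
  [MeasurableSpace (G ⧸ Γ)] [BorelSpace (G ⧸ Γ)] in
/-- `mk ⁻¹' A` is invariant under the right action of `Γ.op` (`γ • x = x * γ` lies in the coset
of `x`). -/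
theorem preimage_smul_preimage_mk (A : Set (G ⧸ Γ)) (γ : Γ.op) :
    (γ • ·) ⁻¹' ((QuotientGroup.mk : G → G ⧸ Γ) ⁻¹' A) =
      (QuotientGroup.mk : G → G ⧸ Γ) ⁻¹' A := by
  ext x
  have hγ : (γ : Gᵐᵒᵖ).unop ∈ Γ := Subgroup.mem_op.1 γ.2
  have hx : ((γ • x : G) : G ⧸ Γ) = (x : G ⧸ Γ) := by
    show ((x * (γ : Gᵐᵒᵖ).unop : G) : G ⧸ Γ) = (x : G ⧸ Γ)
    exact (QuotientGroup.eq.2 (by simpa using hγ)).symm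
  simp only [mem_preimage, hx]

/-- **The quotient measure `μ_𝓕` is `G`-invariant** for a left- and right-invariant `μ`, a
countable `Γ` and a fundamental domain `𝓕` of `Γ.op` — the instance hypothesis
`[SMulInvariantMeasure G (G ⧸ Γ) μ_𝓕]` of rows 59 / 61, with no Polish-space hypothesis. -/
theorem smulInvariantMeasure_quotientMeasure (μ : Measure G) [μ.IsMulLeftInvariant]
    [μ.IsMulRightInvariant] [Countable Γ] {𝓕 : Set G} (h𝓕 : IsFundamentalDomain Γ.op 𝓕 μ) :
    SMulInvariantMeasure G (G ⧸ Γ) (Measure.map (QuotientGroup.mk : G → G ⧸ Γ) (μ.restrict 𝓕)) where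
  measure_preimage_smul g A hA := by
    have hA' : MeasurableSet ((QuotientGroup.mk : G → G ⧸ Γ) ⁻¹' A) := measurable_mk hA
    rw [quotientMeasure_apply μ 𝓕 (measurableSet_preimage (measurable_const_smul g) hA),
      quotientMeasure_apply μ 𝓕 hA, preimage_mk_preimage_smul]
    have h1 : (g * ·) ⁻¹' ((QuotientGroup.mk : G → G ⧸ Γ) ⁻¹' A) ∩ 𝓕 =
        (g * ·) ⁻¹' ((QuotientGroup.mk : G → G ⧸ Γ) ⁻¹' A ∩ g • 𝓕) := by
      rw [preimage_inter]
      congr 1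
      ext x
      simp [mem_smul_set_iff_inv_smul_mem]
    rw [h1, measure_preimage_mul]
    exact (h𝓕.measure_set_eq (h𝓕.smul_of_comm g) hA' (preimage_smul_preimage_mk A)).symm

end Summit.Ventures.HodgeRepro2.T5QuotientMeasureInvariance
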